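import Literature.NumberTheory.Rogawski1990.FinExplicitTransferFactorDeepTauUniform     -- ★ `galAdicCompletionMap_finTauArg_apply` (`σ_w t = t · det g ∕ u²`), `conjLocal_finGammaTwo_mul_finGammaTwo`
import Literature.NumberTheory.Rogawski1990.FinExplicitTransferFactorStableInvariance  -- ★ `IsLocalStablyConjH`-invariance of `χ_g`, `u`, `det g⁻¹`, `τ_v`
import Literature.NumberTheory.Rogawski1990.FinExplicitTransferFactorNondegenerate      -- ★ `isUnit_finGammaTwo`, `isUnit_finTauArg_of_isLocalGRegular`
import Literature.NumberTheory.Rogawski1990.XiLocalCharacter                           -- ★ `localDet : U(J)_v →* E¹_v`, `torusLocalComponent`, `TorusDict.pullback`, `cm_pullback_semilocalComponent`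
import Literature.NumberTheory.Rogawski1990.LocalTransferGlueCM                        -- ★ `totallyDisconnectedSpace_cmDatum_local`
import Literature.NumberTheory.Automorphic.LocalUnitaryIntegralLevel                   -- ★ `isCompact_isOpen_cmLocalIntegralLevel`
import Literature.GroupTheory.PiCharacterFactorsFinitely                               -- ★ `isOpen_ker_units_complex` (profinite groups, no small subgroups in `ℂˣ`)
import Literature.NumberTheory.Rogawski1990.LocalTransferAtOneMuTwist                   -- ★ p846805 (T2) p06 (g15): `exists_nhds_localTransferAtOne_of_finTau_twist`
import HarnessLib

/-!
# The `μ`-TWIST LAW of Rogawski's factor `τ_v`: `τ_v[μχ̃] = ξ_v(det g)⁻¹ · τ_v[μ]` for `χ̃` the base change of a character `ξ` of `U(1)` (Rogawski (1990) §4.9, §12.1)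

Topic `NumberTheory/Rogawski1990`; namespace `Literature.NumberTheory.Rogawski1990`.  THEOREMS ONLY (no definition, no instance, no notation, no named fact,
no `sorry`).  Cell `pub/hodgecm-mathlib`, crux H413, «S3-res» scope note (H1) «μ-TWIST REDUCTION» of the census `CENSUS-S3res-placeGenericity` (p06 (g15)) §5:
organ **(T3)** (holder F0P3-p02 (g15); socket = the `hτ ∕ hρ ∕ hρc ∕ hρs` hypotheses of p06's (T2) `exists_nhds_localTransferAtOne_of_finTau_twist`,
`Literature/NumberTheory/Rogawski1990/LocalTransferAtOneMuTwist.lean`).  HONEST LABEL: HC_CM is proved only modulo the 2 remaining named inputs (hLiu418 24832,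
h413 24833) until rung 0 closes; this file is local algebra of the transfer factor and moves no count.

THE MATHEMATICS.  `τ_v[μ](γ_H) = μ_v(u) · μ_v(t)⁻¹`, `u = γ₂`, `t = (γ₂γ₁⁻¹ − 1)(1 − γ₂γ₃⁻¹) = −χ_g(u)∕det g` [Rogawski1990 §4.9 p. 55] (★ `finTau`,
`finTauArg`), with `μ_v` the semi-local component of the Hecke character `μ` of `L` at `v` (★ `finHeckeValue`, value `0` at non-units).
§1 `μ ↦ τ_v[μ](γ_H)` is multiplicative: `τ_v[μχ] = τ_v[χ] · τ_v[μ]` (every `γ_H`, every `v`).  §2 At a NON-SPLIT `v` (one place `w ∣ v`, `σ_w` the conjugation of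
`L_w ∕ L⁺_v`): `u ∈ U(1)` and `σ_w(t) = t · det g ∕ u²` (★ `galAdicCompletionMap_finTauArg_apply`: the unitarity of `g`), so for the BASE CHANGE
`χ̃ = ξ ∘ (z ↦ z̄ ∕ z)` of an automorphic character `ξ` of the norm-one torus `T = U(1)_{L∕L⁺}` (★ `TorusDict.pullback`; `χ̃_v(x) = ξ_v(x ∕ x̄)⁻¹`, ★
`cm_pullback_semilocalComponent`) one gets `χ̃_v(u) = ξ_v(u)⁻²`, `χ̃_v(t) = ξ_v(u² ∕ det g)⁻¹`, hence **`τ_v[χ̃](γ_H) = ξ_v(det g)⁻¹`** whenever `t` is a unit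
(e.g. `γ_H` `G`-regular) and `τ_v[μχ̃] = ξ_v(det g)⁻¹ · τ_v[μ]` for EVERY `γ_H` (both sides vanish when `t` is not a unit) [Rogawski1990 §12.1 p. 172: «`χ̃(a) =
χ(a∕ā)`»].  §3 `ρ := ξ_v ∘ det⁻¹ ∘ pr₁ : H_v → ℂ` is locally constant (a continuous character of the totally disconnected `U(Φ₂)(L⁺_v)`, which has the compact
open subgroup `K_{2,v}`: open kernel, ★ `isOpen_ker_units_complex`), conjugation-invariant and constant on stable classes (`det` is).  §4 Two Hecke characters
`μ, μ′` of `L` with the same restriction to `𝕀_{L⁺}` differ by such a `χ̃` (idelic Hilbert 90, ★ `TorusDict.exists_pullback_eq`), so `τ_v[μ′] = ρ · τ_v[μ]` on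
all of `H_v` with `ρ` as in §3 — the input of the twist reduction (T2).

## References
* [Rogawski1990] J. D. Rogawski, *Automorphic Representations of Unitary Groups in Three Variables*, Ann. of Math. Stud. 123 (1990): §4.9 p. 55 (`τ`, `Δ_{G∕H}`);
  §12.1 pp. 171–172 (`χ̃(a) = χ(a∕ā)`, characters of `E¹`); §3.13.
* [LanglandsShelstad1987] R. P. Langlands, D. Shelstad, *On the definition of transfer factors*, Math. Ann. 278 (1987), §4.2 (dependence on the `χ`-data).
* [CasselsFrohlichANT1967] J. W. S. Cassels, A. Fröhlich (eds.), *Algebraic Number Theory* (1967), Ch. VII (Tate) §7.4 (idelic Hilbert 90).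
-/

set_option autoImplicit false

noncomputable section

open NumberField IsDedekindDomain Matrix Topology Filter
open Literature.NumberTheory.Automorphic Literature.NumberTheory.Automorphic.UnitaryGroup Literature.NumberTheory.GaloisRepresentations
open Literature.NumberTheory.Automorphic.Arthur2013.Leaves.TECR
open scoped MatrixGroups

namespace Literature.NumberTheory.Rogawski1990

/-! ## §1 `μ ↦ μ_v(x)` and `μ ↦ τ_v[μ](γ_H)` are multiplicative (any finite place) -/

section Multiplicative

variable (L : Type) [Field L] [NumberField L] (v : HeightOneSpectrum (𝓞 ↥(maximalRealSubfield L)))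

/-- `(μχ)_v(x) = μ_v(x) · χ_v(x)` (at a non-unit both sides are `0`). [cite: Rogawski1990, §4.9 p. 55] -/
theorem finHeckeValue_mul_heckeCharacter (μ χ : HeckeCharacter L) (x : UnitaryGroup.LocalRing L v) :
    finHeckeValue L v (μ * χ) x = finHeckeValue L v μ x * finHeckeValue L v χ x := by
  by_cases hx : IsUnit x
  · rw [finHeckeValue_of_isUnit L v _ hx, finHeckeValue_of_isUnit L v _ hx, finHeckeValue_of_isUnit L v _ hx, semilocalComponent_apply,
      semilocalComponent_apply, semilocalComponent_apply, HeckeCharacter.mul_apply, Units.val_mul]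
  · rw [finHeckeValue_of_not_isUnit L v _ hx, finHeckeValue_of_not_isUnit L v _ hx, zero_mul]

/-- `(μ⁻¹)_v(x) = μ_v(x)⁻¹` (at a non-unit both sides are `0`). [cite: Rogawski1990, §4.9 p. 55] -/
theorem finHeckeValue_inv_heckeCharacter (μ : HeckeCharacter L) (x : UnitaryGroup.LocalRing L v) :
    finHeckeValue L v μ⁻¹ x = (finHeckeValue L v μ x)⁻¹ := by
  by_cases hx : IsUnit x
  · rw [finHeckeValue_of_isUnit L v _ hx, finHeckeValue_of_isUnit L v _ hx, semilocalComponent_apply, semilocalComponent_apply,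
      HeckeCharacter.inv_apply, Units.val_inv_eq_inv_val]
  · rw [finHeckeValue_of_not_isUnit L v _ hx, finHeckeValue_of_not_isUnit L v _ hx, _root_.inv_zero]

variable [IsCMField L]
  (γH : (cmDatum L 2 (Matrix.of fun i j : Fin 2 => if i.val + j.val + 1 = 2 then (1 : L) else 0)).Local v ×
    (cmDatum L 1 (Matrix.of fun i j : Fin 1 => if i.val + j.val + 1 = 1 then (1 : L) else 0)).Local v)

/-- **`τ_v[μχ](γ_H) = τ_v[χ](γ_H) · τ_v[μ](γ_H)`** — `μ` enters `τ_v` through the character values `μ_v(u)`, `μ_v(t)` only. [cite: Rogawski1990, §4.9 p. 55] -/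
theorem finTau_mul_heckeCharacter (μ χ : HeckeCharacter L) : finTau L v γH (μ * χ) = finTau L v γH χ * finTau L v γH μ := by
  unfold finTau
  rw [finHeckeValue_mul_heckeCharacter, finHeckeValue_mul_heckeCharacter, mul_inv]
  ring

/-- `τ_v[μ](γ_H) = 0` off the units of `t = −χ_g(u)∕det g` (bookkeeping value of ★ `finHeckeValue`). [cite: Rogawski1990, §4.9 p. 55] -/
theorem finTau_of_not_isUnit_finTauArg (μ : HeckeCharacter L) (ht : ¬ IsUnit (finTauArg L v γH)) : finTau L v γH μ = 0 := by
  unfold finTau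
  rw [finHeckeValue_of_not_isUnit L v μ ht, _root_.inv_zero, mul_zero]

end Multiplicative

/-! ## §2 At a non-split place: `τ_v[χ̃](γ_H) = ξ_v(det g)⁻¹` for the base change `χ̃` of a character `ξ` of `U(1)` -/

section Nonsplit

variable (L : Type) [Field L] [NumberField L] [IsCMField L] {v : HeightOneSpectrum (𝓞 ↥(maximalRealSubfield L))}
  (w : PlacesOver L v) (hw : IsCMField.complexConj L • w.1 = w.1)
  (γH : (cmDatum L 2 (Matrix.of fun i j : Fin 2 => if i.val + j.val + 1 = 2 then (1 : L) else 0)).Local v ×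
    (cmDatum L 1 (Matrix.of fun i j : Fin 1 => if i.val + j.val + 1 = 1 then (1 : L) else 0)).Local v)

include hw in
/-- **`σ(t) · u² = t · det g` in `L ⊗ L⁺_v`** at a non-split `v` (`t = −χ_g(u)∕det g`; ★ `galAdicCompletionMap_finTauArg_apply` read at the unique place `w ∣ v`).
[cite: Rogawski1990, §4.9 p. 55] -/
theorem conjLocal_finTauArg_mul_sq (γH : (cmDatum L 2 (Matrix.of fun i j : Fin 2 => if i.val + j.val + 1 = 2 then (1 : L) else 0)).Local v ×
      (cmDatum L 1 (Matrix.of fun i j : Fin 1 => if i.val + j.val + 1 = 1 then (1 : L) else 0)).Local v) :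
    conjLocal L (IsCMField.complexConj L) v (finTauArg L v γH) * finGammaTwo L v γH ^ 2 =
      finTauArg L v γH * (γH.1.val.val : Matrix (Fin 2) (Fin 2) (UnitaryGroup.LocalRing L v)).det := by
  haveI : Algebra.IsQuadraticExtension ↥(maximalRealSubfield L) L := IsCMField.isQuadraticExtension L
  haveI : Subsingleton (PlacesOver L v) := PlacesOver.subsingleton_of_smul_eq (IsCMField.complexConj L) (IsCMField.complexConj_ne_one (K := L)) w hw
  funext w'
  obtain rfl : w' = w := Subsingleton.elim _ _
  have hdw : ((γH.1.val.val : Matrix (Fin 2) (Fin 2) (UnitaryGroup.LocalRing L v)).map (Pi.evalRingHom (fun w'' : PlacesOver L v => w''.1.adicCompletion L) w')).det =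
      (γH.1.val.val : Matrix (Fin 2) (Fin 2) (UnitaryGroup.LocalRing L v)).det w' :=
    (RingHom.map_det (Pi.evalRingHom (fun w'' : PlacesOver L v => w''.1.adicCompletion L) w') _).symm
  have hu : galAdicCompletionMap (L := L) (IsCMField.complexConj L) hw (finGammaTwo L v γH w') * finGammaTwo L v γH w' = 1 := by
    have h := congrArg (fun y : UnitaryGroup.LocalRing L v => y w') (conjLocal_finGammaTwo_mul_finGammaTwo L v γH)
    simpa only [Pi.mul_apply, Pi.one_apply, conjLocal_apply_eq_galAdicCompletionMap L v w' hw] using h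
  have hu0 : finGammaTwo L v γH w' ≠ 0 := fun h0 => by rw [h0, mul_zero] at hu; exact zero_ne_one hu
  rw [Pi.mul_apply, Pi.mul_apply, Pi.pow_apply, conjLocal_apply_eq_galAdicCompletionMap L v w' hw, galAdicCompletionMap_finTauArg_apply L v w' hw γH, hdw,
    mul_assoc, div_mul_cancel₀ _ (pow_ne_zero 2 hu0)]

include hw in
/-- **`τ_v[χ̃](γ_H) = ξ_v(det g)⁻¹`** for `χ̃ = ξ ∘ (z ↦ z̄∕z)` the base change (★ `TorusDict.pullback`) of an automorphic character `ξ` of `U(1)_{L∕L⁺}(𝔸)`, at a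
non-split `v`, whenever `t` is a unit: `χ̃_v(u) = ξ_v(u∕ū)⁻¹ = ξ_v(u)⁻²`, `χ̃_v(t)⁻¹ = ξ_v(t∕t̄) = ξ_v(u²∕det g)`. [cite: Rogawski1990, §12.1 p. 172; §4.9 p. 55] -/
theorem finTau_pullback_eq_of_isUnit
    (ξ : ↥(TorusDict.torus (IsCMField.complexConj L)) →ₜ* ℂˣ) (hξ : TorusDict.IsAutomorphic (IsCMField.complexConj L) ξ)
    (ht : IsUnit (finTauArg L v γH)) :
    finTau L v γH (TorusDict.pullback (IsCMField.complexConj L) (Algebra.IsQuadraticExtension.finrank_eq_two _ L) (IsCMField.complexConj_ne_one (K := L)) ξ hξ) =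
      (((torusLocalComponent L (IsCMField.complexConj L) v ξ
          (localDet (IsCMField.complexConj L) v (isUnit_antidiagOne_det L 2) γH.1))⁻¹ : ℂˣ) : ℂ) := by
  haveI : Algebra.IsQuadraticExtension ↥(maximalRealSubfield L) L := IsCMField.isQuadraticExtension L
  haveI : Subsingleton (PlacesOver L v) := PlacesOver.subsingleton_of_smul_eq (IsCMField.complexConj L) (IsCMField.complexConj_ne_one (K := L)) w hw
  have hu : IsUnit (finGammaTwo L v γH) := isUnit_finGammaTwo L v γH
  -- `u ∈ U(1)`: `σ(u) u = 1`, so `σ(u)⁻¹ = u` in the units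
  have hcu : Units.map (conjLocal L (IsCMField.complexConj L) v : UnitaryGroup.LocalRing L v →* UnitaryGroup.LocalRing L v) hu.unit * hu.unit = 1 :=
    Units.ext (by rw [Units.val_mul, Units.coe_map, MonoidHom.coe_coe, hu.unit_spec, Units.val_one]; exact conjLocal_finGammaTwo_mul_finGammaTwo L v γH)
  have hinv : (Units.map (conjLocal L (IsCMField.complexConj L) v : UnitaryGroup.LocalRing L v →* UnitaryGroup.LocalRing L v) hu.unit)⁻¹ = hu.unit := inv_eq_of_mul_eq_one_right hcu
  have huN : hu.unit ∈ normOneUnits (conjLocal L (IsCMField.complexConj L) v) :=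
    (mem_normOneUnits_iff _).2 (by rw [hu.unit_spec]; exact conjLocal_finGammaTwo_mul_finGammaTwo L v γH)
  -- `u ∕ ū = u²` in `U(1)`
  have hqu : quotConj (conjLocal L (IsCMField.complexConj L) v) (conjLocal_conjLocal_cm L v) hu.unit =
      (⟨hu.unit, huN⟩ : ↥(normOneUnits (conjLocal L (IsCMField.complexConj L) v))) ^ 2 :=
    Subtype.ext (by rw [coe_quotConj, hinv, Subgroup.coe_pow, pow_two])
  -- `t ∕ t̄ = u² ∕ det g` in `U(1)`: the unitarity law `σ(t)·u² = t·det g` in the units of `L ⊗ L⁺_v`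
  have hlaw : Units.map (conjLocal L (IsCMField.complexConj L) v : UnitaryGroup.LocalRing L v →* UnitaryGroup.LocalRing L v) ht.unit * hu.unit ^ 2 =
      ht.unit * Matrix.GeneralLinearGroup.det γH.1.val :=
    Units.ext (by
      rw [Units.val_mul, Units.val_mul, Units.coe_map, MonoidHom.coe_coe, Units.val_pow_eq_pow_val, ht.unit_spec, hu.unit_spec,
        Matrix.GeneralLinearGroup.val_det_apply]
      exact conjLocal_finTauArg_mul_sq L w hw γH)
  have hqt : quotConj (conjLocal L (IsCMField.complexConj L) v) (conjLocal_conjLocal_cm L v) ht.unit =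
      (⟨hu.unit, huN⟩ : ↥(normOneUnits (conjLocal L (IsCMField.complexConj L) v))) ^ 2 *
        (localDet (IsCMField.complexConj L) v (isUnit_antidiagOne_det L 2) γH.1)⁻¹ :=
    Subtype.ext (by
      rw [coe_quotConj, Subgroup.coe_mul, Subgroup.coe_inv, Subgroup.coe_pow, ← div_eq_mul_inv, ← div_eq_mul_inv, div_eq_div_iff_mul_eq_mul]
      exact hlaw.symm.trans (mul_comm _ _))
  unfold finTau
  rw [finHeckeValue_of_isUnit L v _ hu, finHeckeValue_of_isUnit L v _ ht, cm_pullback_semilocalComponent L ξ hξ hu.unit,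
    cm_pullback_semilocalComponent L ξ hξ ht.unit, hqu, hqt, ← Units.val_inv_eq_inv_val, ← Units.val_mul, inv_inv, map_mul, map_inv,
    inv_mul_cancel_left]

include hw in
/-- **THE TWIST LAW `τ_v[μχ̃](γ_H) = ξ_v(det g)⁻¹ · τ_v[μ](γ_H)`** for every `γ_H ∈ H_v` at a non-split `v` (both sides vanish when `t` is not a unit).
[cite: Rogawski1990, §12.1 p. 172; §4.9 p. 55] [cite: LanglandsShelstad1987, §4.2] -/
theorem finTau_mul_pullback
    (ξ : ↥(TorusDict.torus (IsCMField.complexConj L)) →ₜ* ℂˣ) (hξ : TorusDict.IsAutomorphic (IsCMField.complexConj L) ξ) (μ : HeckeCharacter L) :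
    finTau L v γH (μ * TorusDict.pullback (IsCMField.complexConj L) (Algebra.IsQuadraticExtension.finrank_eq_two _ L) (IsCMField.complexConj_ne_one (K := L)) ξ hξ) =
      (((torusLocalComponent L (IsCMField.complexConj L) v ξ
          (localDet (IsCMField.complexConj L) v (isUnit_antidiagOne_det L 2) γH.1))⁻¹ : ℂˣ) : ℂ) * finTau L v γH μ := by
  by_cases ht : IsUnit (finTauArg L v γH)
  · rw [finTau_mul_heckeCharacter, finTau_pullback_eq_of_isUnit L w hw γH ξ hξ ht]
  · rw [finTau_of_not_isUnit_finTauArg L v γH _ ht, finTau_of_not_isUnit_finTauArg L v γH _ ht, mul_zero]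

end Nonsplit

/-! ## §3 `ρ = ξ_v(det g)⁻¹` is locally constant, conjugation-invariant and constant on stable classes -/

section Rho

variable (L : Type) [Field L] [NumberField L] [IsCMField L] (v : HeightOneSpectrum (𝓞 ↥(maximalRealSubfield L)))
  (ξ : ↥(TorusDict.torus (IsCMField.complexConj L)) →ₜ* ℂˣ)

/-- A continuous `ℂˣ`-valued character of a totally disconnected topological group with a compact open subgroup has open kernel (the restriction to the
profinite subgroup does, ★ `isOpen_ker_units_complex`). [cite: Rogawski1990, §12.1 p. 171] -/
theorem isOpen_ker_of_isCompact_isOpen_subgroup {G : Type} [Group G] [TopologicalSpace G] [IsTopologicalGroup G] [TotallyDisconnectedSpace G]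
    (K : Subgroup G) (hKc : IsCompact (K : Set G)) (hKo : IsOpen (K : Set G)) (c : G →* ℂˣ) (hc : Continuous c) : IsOpen (c.ker : Set G) := by
  haveI : CompactSpace K := isCompact_iff_compactSpace.mp hKc
  have hK : IsOpen (((c.comp K.subtype).ker : Subgroup K) : Set K) :=
    Literature.GroupTheory.PiCharacter.isOpen_ker_units_complex (c.comp K.subtype) (hc.comp continuous_subtype_val)
  refine Subgroup.isOpen_mono (H₁ := ((c.comp K.subtype).ker.map K.subtype)) (fun x hx => ?_) ?_
  · obtain ⟨y, hy, rfl⟩ := Subgroup.mem_map.1 hx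
    exact hy
  · have himg : ((((c.comp K.subtype).ker.map K.subtype : Subgroup G)) : Set G) = Subtype.val '' ((((c.comp K.subtype).ker : Subgroup K)) : Set K) := by
      ext x
      simp only [Subgroup.coe_map, Subgroup.coe_subtype]
    rw [himg]
    exact hKo.isOpenEmbedding_subtypeVal.isOpenMap _ hK

/-- A homomorphism with open kernel is locally constant (constant on the cosets `x · ker`). [cite: Rogawski1990, §12.1 p. 171] -/
theorem isLocallyConstant_of_isOpen_ker {G T : Type*} [Group G] [TopologicalSpace G] [IsTopologicalGroup G] [Group T]
    (f : G →* T) (hf : IsOpen (f.ker : Set G)) : IsLocallyConstant f := by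
  refine (IsLocallyConstant.iff_exists_open f).2 fun x => ⟨(fun y => x * y) '' (f.ker : Set G), (Homeomorph.mulLeft x).isOpenMap _ hf,
    ⟨1, f.ker.one_mem, mul_one x⟩, ?_⟩
  rintro _ ⟨k, hk, rfl⟩
  rw [map_mul, (MonoidHom.mem_ker).1 hk, mul_one]

/-- **`γ_H ↦ ξ_v(det g)⁻¹` is locally constant on `H_v`** (`det : U(Φ₂)(L⁺_v) → U(1)` and `ξ_v` are continuous characters; `U(Φ₂)(L⁺_v)` is totally disconnected with the
compact open `K_{2,v}`). [cite: Rogawski1990, §12.1 p. 171; §3.13] -/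
theorem isLocallyConstant_torusLocalComponent_localDet_inv :
    IsLocallyConstant fun γH : (cmDatum L 2 (Matrix.of fun i j : Fin 2 => if i.val + j.val + 1 = 2 then (1 : L) else 0)).Local v ×
        (cmDatum L 1 (Matrix.of fun i j : Fin 1 => if i.val + j.val + 1 = 1 then (1 : L) else 0)).Local v =>
      (((torusLocalComponent L (IsCMField.complexConj L) v ξ (localDet (IsCMField.complexConj L) v (isUnit_antidiagOne_det L 2) γH.1))⁻¹ : ℂˣ) : ℂ) := by
  haveI := totallyDisconnectedSpace_cmDatum_local L 2 (Matrix.of fun i j : Fin 2 => if i.val + j.val + 1 = 2 then (1 : L) else 0) v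
  obtain ⟨hKc, hKo⟩ := isCompact_isOpen_cmLocalIntegralLevel L 2 (Matrix.of fun i j : Fin 2 => if i.val + j.val + 1 = 2 then (1 : L) else 0) v
  have hf : Continuous ((torusLocalComponent L (IsCMField.complexConj L) v ξ).comp (localDet (IsCMField.complexConj L) v (isUnit_antidiagOne_det L 2))) :=
    (ξ.continuous.comp (continuous_locTorusIncl L (IsCMField.complexConj L))).comp (continuous_localDet (IsCMField.complexConj L) v (isUnit_antidiagOne_det L 2))
  have hlc := isLocallyConstant_of_isOpen_ker _
    (isOpen_ker_of_isCompact_isOpen_subgroup (cmLocalIntegralLevel L 2 (Matrix.of fun i j : Fin 2 => if i.val + j.val + 1 = 2 then (1 : L) else 0) v) hKc hKo _ hf)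
  exact (hlc.comp_continuous continuous_fst).comp (fun z : ℂˣ => ((z⁻¹ : ℂˣ) : ℂ))

/-- `ξ_v(det g)⁻¹` is conjugation-invariant on `H_v`. [cite: Rogawski1990, §12.1 p. 171] -/
theorem torusLocalComponent_localDet_conj
    (g x : (cmDatum L 2 (Matrix.of fun i j : Fin 2 => if i.val + j.val + 1 = 2 then (1 : L) else 0)).Local v ×
      (cmDatum L 1 (Matrix.of fun i j : Fin 1 => if i.val + j.val + 1 = 1 then (1 : L) else 0)).Local v) :
    (((torusLocalComponent L (IsCMField.complexConj L) v ξ (localDet (IsCMField.complexConj L) v (isUnit_antidiagOne_det L 2) (g * x * g⁻¹).1))⁻¹ : ℂˣ) : ℂ) =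
      (((torusLocalComponent L (IsCMField.complexConj L) v ξ (localDet (IsCMField.complexConj L) v (isUnit_antidiagOne_det L 2) x.1))⁻¹ : ℂˣ) : ℂ) := by
  have key : ((localDet (IsCMField.complexConj L) v (isUnit_antidiagOne_det L 2)).comp
        (MonoidHom.fst ((cmDatum L 2 (Matrix.of fun i j : Fin 2 => if i.val + j.val + 1 = 2 then (1 : L) else 0)).Local v) ((cmDatum L 1 (Matrix.of fun i j : Fin 1 => if i.val + j.val + 1 = 1 then (1 : L) else 0)).Local v))) (g * x * g⁻¹) =
      ((localDet (IsCMField.complexConj L) v (isUnit_antidiagOne_det L 2)).comp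
        (MonoidHom.fst ((cmDatum L 2 (Matrix.of fun i j : Fin 2 => if i.val + j.val + 1 = 2 then (1 : L) else 0)).Local v) ((cmDatum L 1 (Matrix.of fun i j : Fin 1 => if i.val + j.val + 1 = 1 then (1 : L) else 0)).Local v))) x := by
    rw [map_mul, map_mul, map_inv, mul_inv_cancel_comm]
  exact congrArg (fun t => (((torusLocalComponent L (IsCMField.complexConj L) v ξ t)⁻¹ : ℂˣ) : ℂ)) key

/-- `ξ_v(det g)⁻¹` is constant on the stable classes of `H_v` (★ `IsLocalStablyConjH`: the `U(Φ₂)`-parts are conjugate in `GL₂(L ⊗ L⁺_v)`). [cite: Rogawski1990, §12.1 p. 171; §3.1 p. 19] -/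
theorem torusLocalComponent_localDet_eq_of_isLocalStablyConjH
    (a b : (cmDatum L 2 (Matrix.of fun i j : Fin 2 => if i.val + j.val + 1 = 2 then (1 : L) else 0)).Local v ×
      (cmDatum L 1 (Matrix.of fun i j : Fin 1 => if i.val + j.val + 1 = 1 then (1 : L) else 0)).Local v) (h : IsLocalStablyConjH L v a b) :
    (((torusLocalComponent L (IsCMField.complexConj L) v ξ (localDet (IsCMField.complexConj L) v (isUnit_antidiagOne_det L 2) b.1))⁻¹ : ℂˣ) : ℂ) =
      (((torusLocalComponent L (IsCMField.complexConj L) v ξ (localDet (IsCMField.complexConj L) v (isUnit_antidiagOne_det L 2) a.1))⁻¹ : ℂˣ) : ℂ) := by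
  obtain ⟨c, hc⟩ := isConj_iff.1 h.1
  have hdet : localDet (IsCMField.complexConj L) v (isUnit_antidiagOne_det L 2) b.1 = localDet (IsCMField.complexConj L) v (isUnit_antidiagOne_det L 2) a.1 :=
    Subtype.ext (Units.ext (by rw [coe_coe_localDet, coe_coe_localDet, ← hc, Units.val_mul, Units.val_mul, Matrix.det_units_conj]))
  rw [hdet]

end Rho

/-! ## §4 Two Hecke characters with the same restriction to `𝕀_{L⁺}`: `τ_v[μ′] = ρ · τ_v[μ]` with `ρ` locally constant, a stable class function -/

section Twist

variable (L : Type) [Field L] [NumberField L] [IsCMField L] {v : HeightOneSpectrum (𝓞 ↥(maximalRealSubfield L))}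
  (w : PlacesOver L v) (hw : IsCMField.complexConj L • w.1 = w.1)

include hw in
/-- **(T3) THE INPUT OF THE `μ`-TWIST REDUCTION.**  If `μ, μ′` are Hecke characters of `L` with the same restriction to `𝕀_{L⁺}` (e.g. both restrict to `ω_{L∕L⁺}`),
then at a NON-SPLIT `v` there is `ρ : H_v → ℂ`, locally constant, conjugation-invariant and constant on stable classes, with `τ_v[μ′](γ_H) = ρ(γ_H) · τ_v[μ](γ_H)`
for EVERY `γ_H ∈ H_v` — namely `ρ = ξ_v(det g)⁻¹` for `μ′μ⁻¹ = χ̃_ξ` (idelic Hilbert 90, ★ `TorusDict.exists_pullback_eq`).  These are exactly the hypotheses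
`hρ hρc hρs hτ` (with `V₀ = univ`) of the twist reduction (T2) `exists_nhds_localTransferAtOne_of_finTau_twist`. [cite: Rogawski1990, §12.1 p. 172; §4.9 p. 55]
[cite: CasselsFrohlichANT1967, Ch. VII §7.4] [cite: LanglandsShelstad1987, §4.2] -/
theorem exists_finTau_eq_mul_of_ideleBaseChange_eq (μ μ' : HeckeCharacter L)
    (hμμ' : ∀ a : ideleGroup ↥(maximalRealSubfield L),
      μ' (AdeleRing.ideleBaseChange ↥(maximalRealSubfield L) L a) = μ (AdeleRing.ideleBaseChange ↥(maximalRealSubfield L) L a)) :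
    ∃ ρ : ((cmDatum L 2 (Matrix.of fun i j : Fin 2 => if i.val + j.val + 1 = 2 then (1 : L) else 0)).Local v ×
        (cmDatum L 1 (Matrix.of fun i j : Fin 1 => if i.val + j.val + 1 = 1 then (1 : L) else 0)).Local v) → ℂ,
      IsLocallyConstant ρ ∧
      (∀ g x, ρ (g * x * g⁻¹) = ρ x) ∧
      (∀ a b, IsLocalStablyConjH L v a b → ρ b = ρ a) ∧
      ∀ γH, finTau L v γH μ' = ρ γH * finTau L v γH μ := by
  haveI : Algebra.IsQuadraticExtension ↥(maximalRealSubfield L) L := IsCMField.isQuadraticExtension L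
  have hχ1 : ∀ a : ideleGroup ↥(maximalRealSubfield L), (μ' * μ⁻¹) (AdeleRing.ideleBaseChange ↥(maximalRealSubfield L) L a) = 1 := fun a => by
    rw [HeckeCharacter.mul_apply, HeckeCharacter.inv_apply, hμμ' a, mul_inv_cancel]
  obtain ⟨ξ, hξ, hξχ⟩ := TorusDict.exists_pullback_eq (IsCMField.complexConj L) (Algebra.IsQuadraticExtension.finrank_eq_two _ L)
    (IsCMField.complexConj_ne_one (K := L)) (μ' * μ⁻¹) hχ1
  have hμ' : μ' = μ * TorusDict.pullback (IsCMField.complexConj L) (Algebra.IsQuadraticExtension.finrank_eq_two _ L) (IsCMField.complexConj_ne_one (K := L)) ξ hξ := by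
    rw [hξχ, mul_comm, inv_mul_cancel_right]
  refine ⟨fun γH => (((torusLocalComponent L (IsCMField.complexConj L) v ξ (localDet (IsCMField.complexConj L) v (isUnit_antidiagOne_det L 2) γH.1))⁻¹ : ℂˣ) : ℂ),
    isLocallyConstant_torusLocalComponent_localDet_inv L v ξ, torusLocalComponent_localDet_conj L v ξ,
    torusLocalComponent_localDet_eq_of_isLocalStablyConjH L v ξ, fun γH => ?_⟩
  rw [hμ']
  exact finTau_mul_pullback L w hw γH ξ hξ μ

end Twist

/-! ## §5 The composed reduction: a `Δ‴_v[μ]`-transfer at the identity is a `Δ‴_v[μ′]`-transfer at the identity whenever `μ| = μ′|` on `𝕀_{L⁺}` -/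

section Reduction

variable (L : Type) [Field L] [NumberField L] [IsCMField L] (H' : Matrix (Fin 3) (Fin 3) L) {v : HeightOneSpectrum (𝓞 ↥(maximalRealSubfield L))}
  (w : PlacesOver L v) (hw : IsCMField.complexConj L • w.1 = w.1)
  [∀ γ : ((cmDatum L 3 H').Local v), MeasurableSpace (((cmDatum L 3 H').Local v) ⧸ Subgroup.centralizer ({γ} : Set ((cmDatum L 3 H').Local v)))]
  [∀ a : ((cmDatum L 2 (Matrix.of fun i j : Fin 2 => if i.val + j.val + 1 = 2 then (1 : L) else 0)).Local v × (cmDatum L 1 (Matrix.of fun i j : Fin 1 => if i.val + j.val + 1 = 1 then (1 : L) else 0)).Local v), MeasurableSpace (((cmDatum L 2 (Matrix.of fun i j : Fin 2 => if i.val + j.val + 1 = 2 then (1 : L) else 0)).Local v × (cmDatum L 1 (Matrix.of fun i j : Fin 1 => if i.val + j.val + 1 = 1 then (1 : L) else 0)).Local v) ⧸ Subgroup.centralizer ({a} : Set ((cmDatum L 2 (Matrix.of fun i j : Fin 2 => if i.val + j.val + 1 = 2 then (1 : L) else 0)).Local v × (cmDatum L 1 (Matrix.of fun i j : Fin 1 =>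 if i.val + j.val + 1 = 1 then (1 : L) else 0)).Local v)))]

include hw in
/-- **(T2) ∘ (T3): THE `μ`-TWIST REDUCTION AT A NON-SPLIT PLACE.**  If `μ, μ′` are Hecke characters of `L` with the same restriction to `𝕀_{L⁺}` and `φ ∈ C_c^∞(G′_v)`
has a `Δ‴_v[μ]`-transfer at the identity (the conclusion of `stub_N6nsS3id` ∕ of ★ `localTransferAtOne_of_hyperspecialLevel_le_two` for `(μ, φ)`), then `φ` has a
`Δ‴_v[μ′]`-transfer at the identity — with `φ^H_{μ′} := ξ_v(det g)⁻¹ · φ^H_μ` (★ p846805 `exists_nhds_localTransferAtOne_of_finTau_twist` fed by §4).  In particular the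
hypothesis «`μ_w` unramified» of the hyperspecial column is needed for ONE `μ` in the class `μ · (𝕀_{L⁺}-trivial characters)` only. [cite: Rogawski1990, §4.9 Prop. 4.9.1 p. 55; §12.1 p. 172]
[cite: LanglandsShelstad1987, §4.2] -/
theorem exists_nhds_localTransferAtOne_of_ideleBaseChange_eq
    (mH : OrbitalMeasureFamily ((cmDatum L 2 (Matrix.of fun i j : Fin 2 => if i.val + j.val + 1 = 2 then (1 : L) else 0)).Local v × (cmDatum L 1 (Matrix.of fun i j : Fin 1 => if i.val + j.val + 1 = 1 then (1 : L) else 0)).Local v)) (mG : OrbitalMeasureFamily ((cmDatum L 3 H').Local v)) (μ μ' : HeckeCharacter L)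
    (hμμ' : ∀ a : ideleGroup ↥(maximalRealSubfield L),
      μ' (AdeleRing.ideleBaseChange ↥(maximalRealSubfield L) L a) = μ (AdeleRing.ideleBaseChange ↥(maximalRealSubfield L) L a))
    (φ : ((cmDatum L 3 H').Local v) → ℂ)
    (h : ∃ V ∈ 𝓝 (1 : ((cmDatum L 2 (Matrix.of fun i j : Fin 2 => if i.val + j.val + 1 = 2 then (1 : L) else 0)).Local v × (cmDatum L 1 (Matrix.of fun i j : Fin 1 => if i.val + j.val + 1 = 1 then (1 : L) else 0)).Local v)), ∃ φH : ((cmDatum L 2 (Matrix.of fun i j : Fin 2 => if i.val + j.val + 1 = 2 then (1 : L) else 0)).Local v × (cmDatum L 1 (Matrix.of fun i j : Fin 1 => if i.val + j.val + 1 = 1 then (1 : L) else 0)).Local v) → ℂ, IsLocSmooth φH ∧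
      ∀ γH ∈ V, IsLocalGRegular L v γH →
        stableOrbitalIntegralRel (IsLocalStablyConjH L v) mH φH γH =
          ∑ᶠ c : ConjClasses ((cmDatum L 3 H').Local v),
            ((finExplicitCollection L H' μ (finExplicitDelta_conj_left_all L H' μ) (finExplicitDelta_conj_right_all L H' μ)) v).Δ γH (Quotient.out c) *
              classOrbitalIntegral mG φ c) :
    ∃ V ∈ 𝓝 (1 : ((cmDatum L 2 (Matrix.of fun i j : Fin 2 => if i.val + j.val + 1 = 2 then (1 : L) else 0)).Local v × (cmDatum L 1 (Matrix.of fun i j : Fin 1 => if i.val + j.val + 1 = 1 then (1 : L) else 0)).Local v)), ∃ φH : ((cmDatum L 2 (Matrix.of fun i j : Fin 2 => if i.val + j.val + 1 = 2 then (1 : L) else 0)).Local v × (cmDatum L 1 (Matrix.of fun i j : Fin 1 => if i.val + j.val + 1 = 1 then (1 : L) else 0)).Local v) → ℂ, IsLocSmooth φH ∧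
      ∀ γH ∈ V, IsLocalGRegular L v γH →
        stableOrbitalIntegralRel (IsLocalStablyConjH L v) mH φH γH =
          ∑ᶠ c : ConjClasses ((cmDatum L 3 H').Local v),
            ((finExplicitCollection L H' μ' (finExplicitDelta_conj_left_all L H' μ') (finExplicitDelta_conj_right_all L H' μ')) v).Δ γH (Quotient.out c) *
              classOrbitalIntegral mG φ c := by
  obtain ⟨ρ, hρ, hρc, hρs, hτ⟩ := exists_finTau_eq_mul_of_ideleBaseChange_eq L w hw μ μ' hμμ'
  exact exists_nhds_localTransferAtOne_of_finTau_twist L H' v mH mG μ μ' ρ hρ hρc hρs Filter.univ_mem (fun γH _ _ => hτ γH) φ h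

end Reduction

end Literature.NumberTheory.Rogawski1990

end
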